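import Summits.RiemannHypothesis.RiemannHypothesis.Theorems.GroundBartaPolarPerronFrobeniusSignImprovingBarrier
import HarnessLib

/-!
# RiemannHypothesis / GroundBarta — crux `PolarPerronFrobenius` (stmt-RiemannHypothesis-18390):
# the EVEN sector of the windowed Weil form is NOT sign-improving at windows `a ≥ 11/20`
# (certified barrier for stub S1, RH-free)

Helper file (`--supports`), RH-free, Mathlib + proved tree files only, no definitions.

The registered RH-bearing stub S1 (`stub_evenConeDense_cofinal`) lives in the EVEN sector: even cone
tests dense among even tests, cofinally.  The companion barrier (`…SignImprovingBarrier.lean`) exhibits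
a sign-changing `f = p − q` with `Re Q(|f|) > Re Q(f)`, but that `f` is ODD-like (bumps at `±d/2`).
Here the same mechanism is run inside the even sector: `p` an even bump at `0`, `q = q₁ + q₁(−·)` the
symmetrised bump at `±d`, `f = p − q` EVEN with `|f| = p + q`, and

  `Re Q(p + q) − Re Q(p − q) = 4 Re W(p ⋆ q̃) ≥ 4 (2cosh(α/2) − w(α)) ∫ p⋆q̃ > 0`

because the (now two-sided) cross kernel `k = p ⋆ q̃ ≥ 0` is supported in `{α ≤ |t| ≤ β}`,
`β < log 2`: polar `≥ 2cosh(α/2)∫k`, no primes, Bombieri arch `= −∫₀^∞ w(t)(k(t)+k(−t))dt ≥ −w(α)∫k`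
(`sw_re_weilFunctional_ge_two_sided`).  With `α = 2/5`, `β = 3/5`: **for every window `a ≥ 11/20`
there is an EVEN real window test `f` with `|f|` again a test and `Re Q(|f|) > Re Q(f)`**
(`sw_even_not_signImproving_of_ge`).  So even-cone density at large windows (S1) cannot come from the
Beurling–Deny map `f ↦ |f|`; cf. the sign-defect criterion (`…SignDefectCriterion.lean`) for what an
`L¹`-small negative part still buys.
Prover B, speedrun unit `sr-gb-rung-b` (rung 3).
-/

set_option linter.dupNamespace false

noncomputable section

open Set MeasureTheory Filter Complex
open scoped Real Topology ComplexConjugate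

namespace Summit.RiemannHypothesis.RiemannHypothesis.Theorems.PolarPerronFrobenius

open Literature.NumberTheory.LFunctions

/-! ## The explicit formula on a non-negative kernel supported in `{α ≤ |t| ≤ β}`, `β < log 2` -/

section Kernel

variable {k : ℝ → ℂ} {α β : ℝ}

/-- **Two-sided version of `sw_re_weilFunctional_ge`.**  For a test kernel `k`, real and `≥ 0`
pointwise, vanishing unless `α ≤ |t| ≤ β` (`0 < α`, `β < log 2`):
`Re W(k) ≥ (2cosh(α/2) − w(α)) ∫ Re k`. [folklore] -/
theorem sw_re_weilFunctional_ge_two_sided (hkt : IsWeilTest k)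
    (hk : ∀ t, k t ≠ 0 → α ≤ |t| ∧ |t| ≤ β) (hα : 0 < α) (hβ : β < Real.log 2)
    (hre : ∀ t, k t = (((k t).re : ℝ) : ℂ)) (hnn : ∀ t, 0 ≤ (k t).re) :
    (2 * Real.cosh (α / 2) - weilArchDensity α) * ∫ t, (k t).re ≤ (weilFunctional k).re := by
  have hkc : Continuous k := hkt.1.continuous
  have hki : Integrable (fun t => (k t).re) := (hkc.integrable_of_hasCompactSupport hkt.2).re
  have hkz : ∀ t, |t| < α → k t = 0 := fun t ht => by
    by_contra h; exact absurd (hk t h).1 (not_le.2 ht)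
  have hk0 : k 0 = 0 := hkz 0 (by rw [abs_zero]; exact hα)
  -- (1) polar term
  have hM : ∀ c : ℝ, weilMellin k ((c : ℂ) + 1 / 2) = ((∫ t, (k t).re * Real.exp (c * t) : ℝ) : ℂ) := by
    intro c
    unfold weilMellin
    rw [← integral_complex_ofReal]
    congr 1 with t
    rw [hre t, Complex.ofReal_re]
    rw [show ((c : ℂ) + 1 / 2 - 1 / 2) * (t : ℂ) = ((c * t : ℝ) : ℂ) by push_cast; ring,
      ← Complex.ofReal_exp]
    push_cast
    ring
  have h0 : weilMellin k 0 = ((∫ t, (k t).re * Real.exp (-(1 / 2) * t) : ℝ) : ℂ) := by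
    have := hM (-(1 / 2)); rwa [show ((-(1 / 2) : ℝ) : ℂ) + 1 / 2 = 0 by push_cast; ring] at this
  have h1 : weilMellin k 1 = ((∫ t, (k t).re * Real.exp ((1 / 2) * t) : ℝ) : ℂ) := by
    have := hM (1 / 2); rwa [show (((1 / 2 : ℝ)) : ℂ) + 1 / 2 = 1 by push_cast; ring] at this
  have hi0 : Integrable fun t => (k t).re * Real.exp (-(1 / 2) * t) :=
    ((Complex.continuous_re.comp hkc).mul (by fun_prop)).integrable_of_hasCompactSupport
      ((hkt.2.comp_left (g := Complex.re) Complex.zero_re).mul_right)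
  have hi1 : Integrable fun t => (k t).re * Real.exp ((1 / 2) * t) :=
    ((Complex.continuous_re.comp hkc).mul (by fun_prop)).integrable_of_hasCompactSupport
      ((hkt.2.comp_left (g := Complex.re) Complex.zero_re).mul_right)
  have hpol : 2 * Real.cosh (α / 2) * ∫ t, (k t).re ≤ (weilPolarTerm k).re := by
    unfold weilPolarTerm
    rw [h0, h1, ← Complex.ofReal_add, Complex.ofReal_re, ← integral_add hi0 hi1, ← integral_const_mul]
    refine integral_mono (hki.const_mul _) (hi0.add hi1) fun t => ?_
    dsimp only
    by_cases hkt0 : k t = 0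
    · have : (k t).re = 0 := by rw [hkt0, Complex.zero_re]
      simp [this]
    · have habs := (hk t hkt0).1
      have hcosh : Real.cosh (α / 2) ≤ Real.cosh (t / 2) := by
        rw [Real.cosh_le_cosh, abs_of_nonneg (by linarith), abs_div, abs_two]
        linarith
      have e1 : Real.exp (-(1 / 2) * t) = Real.exp (-(t / 2)) := by congr 1; ring
      have e2 : Real.exp ((1 / 2) * t) = Real.exp (t / 2) := by congr 1; ring
      have e3 : (k t).re * Real.exp (-(t / 2)) + (k t).re * Real.exp (t / 2) =
          2 * Real.cosh (t / 2) * (k t).re := by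
        rw [Real.cosh_eq]; ring
      rw [e1, e2, e3]
      exact mul_le_mul_of_nonneg_right (by linarith) (hnn t)
  -- (2) prime term
  have hsupp : tsupport k ⊆ Icc (-Real.log 2) (Real.log 2) := by
    refine closure_minimal (fun t ht => ?_) isClosed_Icc
    have h := (hk t ht).2
    rw [mem_Icc]
    constructor <;> linarith [le_abs_self t, neg_abs_le t]
  have hprime : weilPrimeTerm k = 0 := weilPrimeTerm_eq_zero_of_tsupport_subset hkc hsupp
  -- (3) archimedean term (Bombieri's form), two-sided
  have hcongr : ∫ t in Ioi (0 : ℝ), ((Real.exp (t / 2) : ℂ) * (k t + k (-t)) - 2 * k 0) /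
      (2 * Real.sinh t : ℂ) =
      ∫ t in Ioi (0 : ℝ), ((weilArchDensity t * ((k t).re + (k (-t)).re) : ℝ) : ℂ) := by
    refine setIntegral_congr_fun measurableSet_Ioi fun t _ => ?_
    rw [hk0, mul_zero, sub_zero, hre t, hre (-t), Complex.ofReal_re, Complex.ofReal_re]
    unfold weilArchDensity
    push_cast
    ring
  have hpt : ∀ t ∈ Ioi (0 : ℝ), weilArchDensity t * ((k t).re + (k (-t)).re) ≤
      weilArchDensity α * ((k t).re + (k (-t)).re) := by
    intro t ht
    by_cases hz : k t = 0 ∧ k (-t) = 0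
    · simp [hz.1, hz.2]
    · have habs : α ≤ |t| := by
        rcases not_and_or.1 hz with h | h
        · exact (hk t h).1
        · have := (hk (-t) h).1; rwa [abs_neg] at this
      rw [abs_of_pos (mem_Ioi.1 ht)] at habs
      exact mul_le_mul_of_nonneg_right
        (weilArchDensity_antitoneOn (mem_Ioi.2 hα) (mem_Ioi.2 (mem_Ioi.1 ht)) habs)
        (add_nonneg (hnn t) (hnn (-t)))
  have hnn' : ∀ t ∈ Ioi (0 : ℝ), 0 ≤ weilArchDensity t * ((k t).re + (k (-t)).re) := fun t ht =>
    mul_nonneg (weilArchDensity_pos (mem_Ioi.1 ht)).le (add_nonneg (hnn t) (hnn (-t)))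
  have hki' : Integrable fun t => (k t).re + (k (-t)).re := hki.add (hki.comp_neg)
  have hwc : ContinuousOn weilArchDensity (Ioi 0) := by
    unfold weilArchDensity
    refine ContinuousOn.div (by fun_prop) (by fun_prop) fun t ht => ?_
    exact mul_ne_zero two_ne_zero (Real.sinh_pos_iff.2 (mem_Ioi.1 ht)).ne'
  have hmeas : AEStronglyMeasurable (fun t => weilArchDensity t * ((k t).re + (k (-t)).re))
      (volume.restrict (Ioi 0)) :=
    (hwc.mul ((Complex.continuous_re.comp hkc).add
      (Complex.continuous_re.comp (hkc.comp continuous_neg))).continuousOn).aestronglyMeasurable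
      measurableSet_Ioi
  have hint : IntegrableOn (fun t => weilArchDensity t * ((k t).re + (k (-t)).re)) (Ioi 0) := by
    refine Integrable.mono' ((hki'.const_mul (weilArchDensity α)).integrableOn) hmeas ?_
    refine (ae_restrict_iff' measurableSet_Ioi).2 (Eventually.of_forall fun t ht => ?_)
    rw [Real.norm_eq_abs, abs_of_nonneg (hnn' t ht)]
    exact hpt t ht
  have hhalf : ∫ t in Ioi (0 : ℝ), ((k t).re + (k (-t)).re) = ∫ t, (k t).re := by
    rw [integral_add hki.integrableOn hki.comp_neg.integrableOn,
      integral_comp_neg_Ioi 0 (fun t => (k t).re), neg_zero, add_comm]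
    exact intervalIntegral.integral_Iic_add_Ioi hki.integrableOn hki.integrableOn
  have harch : -(weilArchDensity α * ∫ t, (k t).re) ≤ (weilArchTerm k).re := by
    rw [← weilArchTermBombieri_eq_weilArchTerm_holds hkt, weilArchTermBombieri_eq, hcongr, hk0,
      mul_zero, zero_sub, integral_complex_ofReal, Complex.neg_re, Complex.ofReal_re, neg_le_neg_iff,
      ← hhalf]
    calc ∫ t in Ioi (0 : ℝ), weilArchDensity t * ((k t).re + (k (-t)).re)
        ≤ ∫ t in Ioi (0 : ℝ), weilArchDensity α * ((k t).re + (k (-t)).re) :=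
          setIntegral_mono_on hint (hki'.const_mul _).integrableOn measurableSet_Ioi hpt
      _ = weilArchDensity α * ∫ t in Ioi (0 : ℝ), ((k t).re + (k (-t)).re) := integral_const_mul _ _
  unfold weilFunctional
  rw [Complex.add_re, Complex.sub_re, hprime, Complex.zero_re]
  linarith

end Kernel

/-! ## The even barrier -/

/-- **The even sector is not sign-improving (parametric).**  Let `0 < α < β < log 2` with
`w(α) < 2cosh(α/2)`, and `(α + 3β)/4 ≤ a`.  Then there are smooth non-negative EVEN real tests `p, q`
with disjoint supports in `[-a, a]`, both non-zero, with `Re Q(p + q) > Re Q(p − q)`: the even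
sign-changing window test `f = p − q` has `|f| = p + q` and `Re Q(|f|) > Re Q(f)`. [folklore] -/
theorem sw_even_not_signImproving {α β a : ℝ} (hα : 0 < α) (hαβ : α < β) (hβ : β < Real.log 2)
    (hthr : weilArchDensity α < 2 * Real.cosh (α / 2)) (ha : (α + 3 * β) / 4 ≤ a) :
    ∃ p q : ℝ → ℝ, IsWeilTest (fun t => ((p t : ℝ) : ℂ)) ∧ IsWeilTest (fun t => ((q t : ℝ) : ℂ)) ∧
      tsupport p ⊆ Icc (-a) a ∧ tsupport q ⊆ Icc (-a) a ∧ (∀ t, p (-t) = p t) ∧ (∀ t, q (-t) = q t) ∧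
      (∀ t, 0 ≤ p t) ∧ (∀ t, 0 ≤ q t) ∧ (∀ t, p t * q t = 0) ∧ (∀ t, |p t - q t| = p t + q t) ∧
      (∃ t, 0 < p t) ∧ (∃ t, 0 < q t) ∧
      (weilQuadratic (fun t => ((p t - q t : ℝ) : ℂ))).re <
        (weilQuadratic (fun t => ((p t + q t : ℝ) : ℂ))).re := by
  -- geometry: `p` a bump of radius `ρ` at `0`, `q` the symmetrised bump of radius `ρ` at `±d`
  set ρ : ℝ := (β - α) / 4 with hρ
  set d : ℝ := (α + β) / 2 with hd
  have hρ0 : 0 < ρ := by rw [hρ]; linarith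
  have hdρ : ρ < d := by rw [hρ, hd]; linarith
  let pb : ContDiffBump (0 : ℝ) := ⟨ρ / 2, ρ, by positivity, by linarith⟩
  let qb : ContDiffBump d := ⟨ρ / 2, ρ, by positivity, by linarith⟩
  set p : ℝ → ℝ := fun t => pb t with hpdef
  set q : ℝ → ℝ := fun t => qb t + qb (-t) with hqdef
  have hpc : ContDiff ℝ (⊤ : ℕ∞) p := pb.contDiff
  have hqbc : ContDiff ℝ (⊤ : ℕ∞) (fun t => qb t) := qb.contDiff
  have hqc : ContDiff ℝ (⊤ : ℕ∞) q := hqbc.add (hqbc.comp contDiff_neg)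
  have hps : HasCompactSupport p := pb.hasCompactSupport
  have hqbs : HasCompactSupport (fun t => qb t) := qb.hasCompactSupport
  have hqs : HasCompactSupport q := hqbs.add (hqbs.comp_homeomorph (Homeomorph.neg ℝ))
  have hP : IsWeilTest fun t => ((p t : ℝ) : ℂ) := sw_isWeilTest_ofReal_comp hpc hps
  have hQ : IsWeilTest fun t => ((q t : ℝ) : ℂ) := sw_isWeilTest_ofReal_comp hqc hqs
  have hp0 : ∀ t, 0 ≤ p t := fun t => pb.nonneg
  have hq0 : ∀ t, 0 ≤ q t := fun t => add_nonneg qb.nonneg qb.nonneg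
  have hpe : ∀ t, p (-t) = p t := fun t => pb.neg t
  have hqe : ∀ t, q (-t) = q t := fun t => by simp only [hqdef, neg_neg]; ring
  -- where the bumps vanish
  have hpz : ∀ t, ρ ≤ |t| → p t = 0 := fun t ht =>
    pb.zero_of_le_dist (by simpa [Real.dist_eq] using ht)
  have hqbz : ∀ t, ρ ≤ |t - d| → qb t = 0 := fun t ht =>
    qb.zero_of_le_dist (by simpa [Real.dist_eq] using ht)
  have hqz : ∀ t, |t| < d - ρ → q t = 0 := by
    intro t ht
    have h1 : ρ ≤ |t - d| := by
      rw [abs_lt] at ht; rw [le_abs]; right; linarith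
    have h2 : ρ ≤ |-t - d| := by
      rw [abs_lt] at ht; rw [le_abs]; right; linarith
    simp only [hqdef, hqbz t h1, hqbz (-t) h2, add_zero]
  have hqz' : ∀ t, d + ρ ≤ |t| → q t = 0 := by
    intro t ht
    have h1 : ρ ≤ |t - d| := by
      rcases le_abs.1 ht with h | h
      · rw [le_abs]; left; linarith
      · rw [le_abs]; right; linarith
    have h2 : ρ ≤ |-t - d| := by
      rcases le_abs.1 ht with h | h
      · rw [le_abs]; right; linarith
      · rw [le_abs]; left; linarith
    simp only [hqdef, hqbz t h1, hqbz (-t) h2, add_zero]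
  have hdisj : ∀ t, p t * q t = 0 := by
    intro t
    by_cases ht : ρ ≤ |t|
    · rw [hpz t ht, zero_mul]
    · rw [hqz t (by linarith [not_le.1 ht]), mul_zero]
  have habs : ∀ t, |p t - q t| = p t + q t := by
    intro t
    rcases mul_eq_zero.1 (hdisj t) with h | h
    · rw [h, zero_sub, abs_neg, abs_of_nonneg (hq0 t), zero_add]
    · rw [h, sub_zero, abs_of_nonneg (hp0 t), add_zero]
  have hppos : 0 < p 0 := pb.pos_of_mem_ball (Metric.mem_ball_self pb.rOut_pos)
  have hqpos : 0 < q d := by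
    have := qb.pos_of_mem_ball (Metric.mem_ball_self qb.rOut_pos)
    exact add_pos_of_pos_of_nonneg this qb.nonneg
  -- supports inside the window
  have htp : tsupport p ⊆ Icc (-a) a := by
    rw [hpdef, show (fun t => pb t) = (pb : ℝ → ℝ) from rfl, pb.tsupport_eq, Real.closedBall_eq_Icc]
    show Icc (0 - ρ) (0 + ρ) ⊆ Icc (-a) a
    exact Icc_subset_Icc (by linarith) (by linarith)
  have htq : tsupport q ⊆ Icc (-a) a := by
    refine closure_minimal (fun t ht => ?_) isClosed_Icc
    by_contra hI
    apply ht
    apply hqz'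
    rw [mem_Icc, not_and_or, not_le, not_le] at hI
    rw [hρ, hd]
    rcases hI with h | h
    · rw [le_abs]; right; linarith
    · rw [le_abs]; left; linarith
  -- the cross kernel
  set K : ℝ → ℂ := weilConv (fun u => ((p u : ℝ) : ℂ)) (weilReflect fun u => ((q u : ℝ) : ℂ)) with hK
  have hKt : IsWeilTest K := hP.weilConv hQ.weilReflect
  have hKre : ∀ t, K t = (((K t).re : ℝ) : ℂ) := fun t => sw_cross_eq_ofReal_re p q t
  have hKnn : ∀ t, 0 ≤ (K t).re := fun t => sw_cross_re_nonneg hp0 hq0 t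
  -- support of the kernel: `K t ≠ 0 → α ≤ |t| ≤ β`
  have hKsupp : ∀ t, K t ≠ 0 → α ≤ |t| ∧ |t| ≤ β := by
    intro t hKt0
    rw [hK, sw_cross_apply, ne_eq, Complex.ofReal_eq_zero] at hKt0
    -- some `u` with `p u * q (u - t) ≠ 0`
    by_contra hout
    apply hKt0
    refine integral_eq_zero_of_ae (Eventually.of_forall fun u => ?_)
    show p u * q (u - t) = 0
    by_cases hu : ρ ≤ |u|
    · rw [hpz u hu, zero_mul]
    · replace hu := not_le.1 hu
      rw [not_and_or, not_le, not_le] at hout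
      rcases hout with h | h
      · -- `|t| < α`: then `|u - t| < ρ + α ≤ d - ρ`
        rw [hqz (u - t) ?_, mul_zero]
        have : |u - t| ≤ |u| + |t| := abs_sub u t
        rw [hρ, hd] at *
        linarith
      · -- `|t| > β`: then `|u - t| ≥ |t| - |u| > β - ρ = d + ρ`
        rw [hqz' (u - t) ?_, mul_zero]
        have : |t| - |u| ≤ |u - t| := by
          have := abs_sub_abs_le_abs_sub t u; rwa [abs_sub_comm] at this
        rw [hρ, hd] at *
        linarith
  -- `∫ Re K > 0` from `Re K(-d) > 0` (`p` at `0` against the bump of `q` at `d`)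
  have hKc : Continuous fun t => (K t).re := Complex.continuous_re.comp hKt.1.continuous
  have hKi : Integrable fun t => (K t).re := (hKt.1.continuous.integrable_of_hasCompactSupport hKt.2).re
  have hKd : 0 < (K (-d)).re := by
    rw [hK, sw_cross_apply, Complex.ofReal_re]
    have hc : Continuous fun u => p u * q (u - -d) :=
      hpc.continuous.mul (hqc.continuous.comp (continuous_id.sub continuous_const))
    have hi : Integrable fun u => p u * q (u - -d) :=
      hc.integrable_of_hasCompactSupport hps.mul_right
    refine sw_integral_pos hc hi (fun u => mul_nonneg (hp0 u) (hq0 _)) (x := 0) ?_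
    rw [show (0 : ℝ) - -d = d by ring]
    exact mul_pos hppos hqpos
  have hKint : 0 < ∫ t, (K t).re := sw_integral_pos hKc hKi hKnn hKd
  -- assemble
  have hW := sw_re_weilFunctional_ge_two_sided hKt hKsupp hα hβ hKre hKnn
  have hdiff := sw_weilQuadratic_add_sub_sub hP hQ
  have hre : (weilQuadratic (fun u => ((p u + q u : ℝ) : ℂ))).re -
      (weilQuadratic (fun u => ((p u - q u : ℝ) : ℂ))).re = 4 * (weilFunctional K).re := by
    have := congrArg Complex.re hdiff
    simpa [Complex.sub_re, Complex.mul_re] using this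
  have hgap : 0 < (2 * Real.cosh (α / 2) - weilArchDensity α) * ∫ t, (K t).re :=
    mul_pos (by linarith) hKint
  exact ⟨p, q, hP, hQ, htp, htq, hpe, hqe, hp0, hq0, hdisj, habs, ⟨_, hppos⟩, ⟨_, hqpos⟩, by linarith⟩

/-- **Even barrier at every window `a ≥ 11/20`.**  For every `a ≥ 11/20` there is an EVEN real window
test `f = p − q` on `[-a, a]` (even bump at `0` minus the symmetrised bump at `±1/2`, disjoint
supports, so `|f| = p + q` is again an even test) with `Re Q(|f|) > Re Q(f)`: even-cone density at
large windows (stub S1) cannot be obtained from `f ↦ |f|`. [folklore] -/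
theorem sw_even_not_signImproving_of_ge {a : ℝ} (ha : 11 / 20 ≤ a) :
    ∃ p q : ℝ → ℝ, IsWeilTest (fun t => ((p t : ℝ) : ℂ)) ∧ IsWeilTest (fun t => ((q t : ℝ) : ℂ)) ∧
      tsupport p ⊆ Icc (-a) a ∧ tsupport q ⊆ Icc (-a) a ∧ (∀ t, p (-t) = p t) ∧ (∀ t, q (-t) = q t) ∧
      (∀ t, 0 ≤ p t) ∧ (∀ t, 0 ≤ q t) ∧ (∀ t, p t * q t = 0) ∧ (∀ t, |p t - q t| = p t + q t) ∧
      (∃ t, 0 < p t) ∧ (∃ t, 0 < q t) ∧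
      (weilQuadratic (fun t => ((p t - q t : ℝ) : ℂ))).re <
        (weilQuadratic (fun t => ((p t + q t : ℝ) : ℂ))).re := by
  have hlog : (3 / 5 : ℝ) < Real.log 2 := by
    have := Real.log_two_gt_d9; linarith
  have hthr : weilArchDensity (2 / 5) < 2 * Real.cosh ((2 / 5) / 2) := by
    rw [show (2 / 5 : ℝ) / 2 = 1 / 5 by norm_num]; exact sw_weilArchDensity_two_fifths_lt
  exact sw_even_not_signImproving (α := 2 / 5) (β := 3 / 5) (by norm_num) (by norm_num) hlog hthr
    (by linarith)

end Summit.RiemannHypothesis.RiemannHypothesis.Theorems.PolarPerronFrobenius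

end
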